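import Mathlib
import Summits.NavierStokesRegularity.NavierStokesRegularity.Theorems.TaoLadderRungThreeRestartControlSlack
import Literature.Analysis.FluidPDE.Tao2016AveragedNS.ShiftSetCascadeFlows
import Summits.NavierStokesRegularity.NavierStokesRegularity.Theses.TaoLadderRungTwoFlat
import HarnessLib

/-!
# `RestartControlOn` — Tao's scale covariance at a checkpoint on an arbitrary shift set `𝕊`
  (item stmt-NavierStokesRegularity-22989, support of route TaoLadderRungTwoFlat; the S♭ PORT of
  the shared support `RestartControl` = stmt-NavierStokesRegularity-20424,
  `Theorems/TaoLadderRungThreeRestartControl.lean`)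

HONEST FRAMING: bookkeeping about Tao-type MODEL lattice pseudo-flows (Tao 2016, §6.4) in the cell
vocabulary `CascadeODESolutionOnShift 𝕊` / `PseudoFlowOnShift 𝕊` of `ShiftSetCascadeFlows` (the shift
set a PARAMETER; `𝕊 = S♭` for the item). Nothing here is a statement about the Navier–Stokes
equations and nothing is asserted about any particular coefficient table.

**Statement (`RestartControlOn`, verbatim the route decl at `𝕊 = shiftSetFlat`).** For `ε₀ > 0`,
`θ ≤ 1/2`, `c ≥ 0`, `η > 0`, `X₀ i₀ ≠ 0`, `K₁, K₂ ≥ 0` there is `N₀` such that for `n₀ ≥ N₀`, along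
every local pseudo-solution `CascadeODESolutionOnShift 𝕊 T ε₀ α K₁ K₂ n₀ X₀ X E` and every run of
epoch checkpoints up to a level `N ≥ n₀` with `t_N < T`, the family restarted at `(N, t_N, e_N)` is an
`(η, η)`-pseudo-flow `PseudoFlowOnShift 𝕊 ((T − t_N)γ) ε₀ α η η …` (`γ = e_N (1+ε₀)^{5N/2}`) from the
rescaled checkpoint state with slack `restartSlack`, and `0 ≤ restartSlack ≤ η · slackWeight (N − n₀)`.

PROOF = the tree proof of `RestartControl.main` with `quadTerm` replaced by `quadTermOn 𝕊`: the only
table-dependent input is the scale covariance of the quadratic term (`quadTermOn_restartX`, proved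
here for every `𝕊` exactly as `RestartControl.quadTerm_restartX`); every other step (time change,
defect constants `κ_j ≤ η`, the slack over the past epochs) is the table-free bookkeeping of
`…RestartControlTools` / `…RestartControlSlack`, reused verbatim. The tree proof never used (4.11),
which is the one field `CascadeODESolutionOnShift` lacks.
-/

noncomputable section

-- the sub-problem namespace repeats the summit name by design (D-0017)
set_option linter.dupNamespace false

namespace Summit.NavierStokesRegularity.NavierStokesRegularity.Theorems

open Set MeasureTheory intervalIntegral Literature.Analysis.FluidPDE Literature.Analysis.FluidPDE.TaoCascade
open RestartControl

namespace RestartControlOn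

/-! ### Scale covariance of the quadratic term on `𝕊` -/

/-- **Covariance of the restarted quadratic term on the shift set `𝕊`**: the quadratic term of the
restarted amplitudes at shell `k`, time `s`, is the quadratic term of the original amplitudes at shell
`N+k`, time `t_N + s/γ`, divided by `e_N² (1+ε₀)^{5N/2}`.
[cite: Tao2016AveragedNS, §6.4 ("inserting this rescaling into (6.5)–(6.8) gives (6.44)–(6.48)")] -/
theorem quadTermOn_restartX (𝕊 : Finset (ℤ × ℤ × ℤ)) {ε₀ : ℝ} (hq : 0 < 1 + ε₀) {m : ℕ}
    (α : Fin m → Fin m → Fin m → ℤ × ℤ × ℤ → ℝ) (N : ℤ) (tN eN : ℝ) (X : Fin m → ℤ → ℝ → ℝ)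
    (i : Fin m) (k : ℤ) (s : ℝ) :
    quadTermOn 𝕊 ε₀ α (restartX ε₀ N tN eN X) i k s =
      quadTermOn 𝕊 ε₀ α X i (N + k) (tN + s / (eN * (1 + ε₀) ^ ((5 : ℝ) * N / 2))) /
        (eN ^ 2 * (1 + ε₀) ^ ((5 : ℝ) * N / 2)) := by
  unfold quadTermOn
  rw [Finset.sum_div]
  refine Finset.sum_congr rfl fun i₁ _ => ?_
  rw [Finset.sum_div]
  refine Finset.sum_congr rfl fun i₂ _ => ?_
  rw [Finset.sum_div]
  refine Finset.sum_congr rfl fun μ _ => ?_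
  simp only [restartX]
  have hQ : 0 < (1 + ε₀) ^ ((5 : ℝ) * N / 2) := Real.rpow_pos_of_pos hq _
  have hidx₁ : N + (k - μ.2.2 + μ.1) = N + k - μ.2.2 + μ.1 := by ring
  have hidx₂ : N + (k - μ.2.2 + μ.2.1) = N + k - μ.2.2 + μ.2.1 := by ring
  have hpow : (1 + ε₀) ^ ((5 : ℝ) * ((k : ℝ) - (μ.2.2 : ℝ)) / 2) =
      (1 + ε₀) ^ ((5 : ℝ) * (((N + k : ℤ) : ℝ) - (μ.2.2 : ℝ)) / 2) / (1 + ε₀) ^ ((5 : ℝ) * N / 2) := by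
    rw [eq_div_iff hQ.ne', ← Real.rpow_add hq]
    congr 1
    push_cast
    ring
  rw [hidx₁, hidx₂, hpow]
  field_simp

/-! ### The restarted family is an `(η, η)`-pseudo-flow on `𝕊` -/

section Flow

variable {𝕊 : Finset (ℤ × ℤ × ℤ)} {ε₀ θ c η : ℝ} {m : ℕ} {i₀ : Fin m}
  {α : Fin m → Fin m → Fin m → ℤ × ℤ × ℤ → ℝ}
  {K₁ K₂ : ℝ} {n₀ N : ℤ} {X₀ : Fin m → ℝ} {P : (Fin m → ℤ → ℝ) → (Fin m → ℤ → ℝ) → Prop}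
  {T : ℝ} {X E : Fin m → ℤ → ℝ → ℝ} {t e : ℤ → ℝ}

/-- **Scale covariance (Tao §6.4) with small defects, on the shift set `𝕊`**: along a local pseudo-solution on `[0,T]`
with shell checkpoints up to level `N` (`t_N < T`), if `K_j ≤ η |X₀ i₀| (1+ε₀)^{n₀/2}` (`j = 1,2`)
and `θ ≤ 1/2`, the family restarted at `(N, t_N, e_N)` is an `(η, η)`-pseudo-flow on
`[0, (T − t_N) γ]` from the rescaled checkpoint state with slack `restartSlack`.
[cite: Tao2016AveragedNS, §6.4 Prop. 6.5 (i), (ii), (iv) (the rescaled system, defects O((1+ε₀)^{-n₀/2}))] -/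
theorem pseudoFlowOnShift_restart (hε₀ : 0 < ε₀) (hθ : θ ≤ 1 / 2) (hK₁ : 0 ≤ K₁) (hK₂ : 0 ≤ K₂)
    (hK₁η : K₁ ≤ η * |X₀ i₀| * (1 + ε₀) ^ ((n₀ : ℝ) / 2))
    (hK₂η : K₂ ≤ η * |X₀ i₀| * (1 + ε₀) ^ ((n₀ : ℝ) / 2))
    (hsol : CascadeODESolutionOnShift 𝕊 T ε₀ α K₁ K₂ n₀ X₀ X E) (hN : n₀ ≤ N)
    (h : ShellCheckpoints ε₀ θ c i₀ n₀ X₀ P N X E t e) (htT : t N < T) :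
    PseudoFlowOnShift 𝕊 ((T - t N) * (e N * (1 + ε₀) ^ ((5 : ℝ) * N / 2))) ε₀ α η η
      (fun i k => X i (N + k) (t N) / e N) (fun i k => E i (N + k) (t N) / e N ^ 2)
      (restartSlack ε₀ K₂ N (t N) (e N) E) (restartX ε₀ N (t N) (e N) X)
      (restartE ε₀ N (t N) (e N) E) := by
  have hq : (0 : ℝ) < 1 + ε₀ := by linarith
  have heN : 0 < e N := h.e_pos N hN le_rfl
  have htN0 : 0 ≤ t N := h.t_nonneg N hN le_rfl
  have hQ : 0 < (1 + ε₀) ^ ((5 : ℝ) * N / 2) := Real.rpow_pos_of_pos hq _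
  have hQ2 : 0 < (1 + ε₀) ^ ((N : ℝ) / 2) := Real.rpow_pos_of_pos hq _
  set γ : ℝ := e N * (1 + ε₀) ^ ((5 : ℝ) * N / 2) with hγ
  have hγpos : 0 < γ := mul_pos heN hQ
  set τ : ℝ := (T - t N) * γ with hτ
  have hτpos : 0 < τ := mul_pos (by linarith) hγpos
  have hτT : t N + τ / γ = T := by rw [hτ, mul_div_cancel_right₀ _ hγpos.ne']; ring
  have hmaps : MapsTo (fun s => t N + s / γ) (Icc 0 τ) (Icc 0 T) :=
    mapsTo_restart htN0 hγpos hτT.le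
  -- the two rescaled defect constants are `≤ η`
  have hκ₁ : K₁ ≤ η * (e N * (1 + ε₀) ^ ((N : ℝ) / 2)) :=
    (div_le_iff₀ (mul_pos heN hQ2)).mp (kappa_le h hε₀ hθ hN hK₁ hK₁η)
  have hκ₂ : K₂ / (e N * (1 + ε₀) ^ ((N : ℝ) / 2)) ≤ η := kappa_le h hε₀ hθ hN hK₂ hK₂η
  have hη : 0 ≤ η := le_trans (div_nonneg hK₂ (mul_pos heN hQ2).le) hκ₂
  -- the exponent identity `(1+ε₀)^{2(N+k)} (1+ε₀)^{N/2} = (1+ε₀)^{2k} (1+ε₀)^{5N/2}`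
  have hsplit : ∀ k : ℤ, (1 + ε₀) ^ ((2 : ℝ) * ((N + k : ℤ) : ℝ)) * (1 + ε₀) ^ ((N : ℝ) / 2) =
      (1 + ε₀) ^ ((2 : ℝ) * k) * (1 + ε₀) ^ ((5 : ℝ) * N / 2) := by
    intro k
    rw [← Real.rpow_add hq, ← Real.rpow_add hq]
    congr 1
    push_cast
    ring
  -- pointwise facts at the image point `p = t_N + s/γ ∈ [0,T]`
  have hsqrt : ∀ (i : Fin m) (k : ℤ) (s : ℝ), Real.sqrt (restartE ε₀ N (t N) (e N) E i k s) =
      Real.sqrt (E i (N + k) (t N + s / γ)) / e N := by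
    intro i k s
    show Real.sqrt (E i (N + k) (t N + s / γ) / e N ^ 2) = _
    rw [Real.sqrt_div' _ (sq_nonneg _), Real.sqrt_sq heN.le]
  refine
    { contDiffOn_S := fun i k => contDiffOn_restart (hsol.contDiffOn_X i (N + k)) hmaps (e N)
      contDiffOn_F := fun i k => contDiffOn_restart (hsol.contDiffOn_E i (N + k)) hmaps (e N ^ 2)
      nonneg_F := fun i k s hs => div_nonneg (hsol.nonneg_E i (N + k) _ (hmaps hs)) (sq_nonneg _)
      apriori_S := ?_
      apriori_F := ?_
      init_S := fun i k => restartX_zero ε₀ N (t N) (e N) X i k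
      init_F := fun i k => restartE_zero ε₀ N (t N) (e N) E i k
      motion := ?_
      energy := ?_
      defect_lower := ?_
      defect_upper := ?_ }
  · -- (4.5), amplitudes
    obtain ⟨M, hM⟩ := hsol.apriori_X
    refine ⟨(1 + (1 + ε₀) ^ (-(10 : ℝ) * N)) * M / e N, fun s hs i k => ?_⟩
    have hp := hmaps hs
    have hMp := hM _ hp i (N + k)
    show (1 + (1 + ε₀) ^ ((10 : ℝ) * k)) * |X i (N + k) (t N + s / γ) / e N| ≤ _
    rw [abs_div, abs_of_pos heN, ← mul_div_assoc]
    refine div_le_div_of_nonneg_right ?_ heN.le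
    have hA : 0 ≤ 1 + (1 + ε₀) ^ (-(10 : ℝ) * N) := by positivity
    calc (1 + (1 + ε₀) ^ ((10 : ℝ) * k)) * |X i (N + k) (t N + s / γ)|
        ≤ (1 + (1 + ε₀) ^ (-(10 : ℝ) * N)) * (1 + (1 + ε₀) ^ ((10 : ℝ) * ((N + k : ℤ) : ℝ))) *
            |X i (N + k) (t N + s / γ)| :=
          mul_le_mul_of_nonneg_right (weight_le hq N k) (abs_nonneg _)
      _ = (1 + (1 + ε₀) ^ (-(10 : ℝ) * N)) * ((1 + (1 + ε₀) ^ ((10 : ℝ) * ((N + k : ℤ) : ℝ))) *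
            |X i (N + k) (t N + s / γ)|) := by ring
      _ ≤ (1 + (1 + ε₀) ^ (-(10 : ℝ) * N)) * M := mul_le_mul_of_nonneg_left hMp hA
  · -- (4.5), energies
    obtain ⟨M, hM⟩ := hsol.apriori_E
    refine ⟨(1 + (1 + ε₀) ^ (-(10 : ℝ) * N)) * M / e N, fun s hs i k => ?_⟩
    have hp := hmaps hs
    have hMp := hM _ hp i (N + k)
    rw [hsqrt i k s, ← mul_div_assoc]
    refine div_le_div_of_nonneg_right ?_ heN.le
    have hA : 0 ≤ 1 + (1 + ε₀) ^ (-(10 : ℝ) * N) := by positivity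
    calc (1 + (1 + ε₀) ^ ((10 : ℝ) * k)) * Real.sqrt (E i (N + k) (t N + s / γ))
        ≤ (1 + (1 + ε₀) ^ (-(10 : ℝ) * N)) * (1 + (1 + ε₀) ^ ((10 : ℝ) * ((N + k : ℤ) : ℝ))) *
            Real.sqrt (E i (N + k) (t N + s / γ)) :=
          mul_le_mul_of_nonneg_right (weight_le hq N k) (Real.sqrt_nonneg _)
      _ = (1 + (1 + ε₀) ^ (-(10 : ℝ) * N)) * ((1 + (1 + ε₀) ^ ((10 : ℝ) * ((N + k : ℤ) : ℝ))) *
            Real.sqrt (E i (N + k) (t N + s / γ))) := by ring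
      _ ≤ (1 + (1 + ε₀) ^ (-(10 : ℝ) * N)) * M := mul_le_mul_of_nonneg_left hMp hA
  · -- (4.8): scale covariance of the equation of motion, defect `κ₁ ≤ η`
    intro i k s hs
    have hp := hmaps hs
    have hd : derivWithin (restartX ε₀ N (t N) (e N) X i k) (Icc 0 τ) s =
        derivWithin (X i (N + k)) (Icc 0 T) (t N + s / γ) / γ / e N :=
      derivWithin_restart (hsol.contDiffOn_X i (N + k)) hmaps (e N) hτpos hs
    have hquad := quadTermOn_restartX 𝕊 hq α N (t N) (e N) X i k s
    have hD : e N ^ 2 * (1 + ε₀) ^ ((5 : ℝ) * N / 2) = γ * e N := by rw [hγ]; ring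
    rw [hd, hquad, hD, hsqrt i k s, div_div, ← sub_div, abs_div, abs_of_pos (mul_pos hγpos heN),
      div_le_iff₀ (mul_pos hγpos heN)]
    have hmot := hsol.motion i (N + k) _ hp
    have hS := Real.sqrt_nonneg (E i (N + k) (t N + s / γ))
    calc |derivWithin (X i (N + k)) (Icc 0 T) (t N + s / γ) -
            quadTermOn 𝕊 ε₀ α X i (N + k) (t N + s / γ)|
        ≤ K₁ * (1 + ε₀) ^ ((2 : ℝ) * ((N + k : ℤ) : ℝ)) * Real.sqrt (E i (N + k) (t N + s / γ)) :=
          hmot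
      _ ≤ η * (e N * (1 + ε₀) ^ ((N : ℝ) / 2)) * (1 + ε₀) ^ ((2 : ℝ) * ((N + k : ℤ) : ℝ)) *
            Real.sqrt (E i (N + k) (t N + s / γ)) := by gcongr
      _ = η * (1 + ε₀) ^ ((2 : ℝ) * k) * (Real.sqrt (E i (N + k) (t N + s / γ)) / e N) *
            (γ * e N) := by
          rw [show η * (e N * (1 + ε₀) ^ ((N : ℝ) / 2)) * (1 + ε₀) ^ ((2 : ℝ) * ((N + k : ℤ) : ℝ)) *
              Real.sqrt (E i (N + k) (t N + s / γ)) =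
              η * e N * Real.sqrt (E i (N + k) (t N + s / γ)) *
                ((1 + ε₀) ^ ((2 : ℝ) * ((N + k : ℤ) : ℝ)) * (1 + ε₀) ^ ((N : ℝ) / 2)) by ring,
            hsplit k, hγ]
          field_simp
  · -- (4.9): the energy inequality is covariant
    intro i k s hs
    have hp := hmaps hs
    have hdE : derivWithin (restartE ε₀ N (t N) (e N) E i k) (Icc 0 τ) s =
        derivWithin (E i (N + k)) (Icc 0 T) (t N + s / γ) / γ / e N ^ 2 :=
      derivWithin_restart (hsol.contDiffOn_E i (N + k)) hmaps (e N ^ 2) hτpos hs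
    have hquad := quadTermOn_restartX 𝕊 hq α N (t N) (e N) X i k s
    have hS : restartX ε₀ N (t N) (e N) X i k s = X i (N + k) (t N + s / γ) / e N := rfl
    rw [hdE, hquad, hS, div_div]
    have hpos : 0 < γ * e N ^ 2 := by positivity
    calc derivWithin (E i (N + k)) (Icc 0 T) (t N + s / γ) / (γ * e N ^ 2)
        ≤ quadTermOn 𝕊 ε₀ α X i (N + k) (t N + s / γ) * X i (N + k) (t N + s / γ) / (γ * e N ^ 2) :=
          div_le_div_of_nonneg_right (hsol.energy i (N + k) _ hp) hpos.le
      _ = quadTermOn 𝕊 ε₀ α X i (N + k) (t N + s / γ) / (e N ^ 2 * (1 + ε₀) ^ ((5 : ℝ) * N / 2)) *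
            (X i (N + k) (t N + s / γ) / e N) := by
          rw [hγ]
          field_simp
  · -- (4.10), lower
    intro i k s hs
    have hp := hmaps hs
    show (1 / 2) * (X i (N + k) (t N + s / γ) / e N) ^ 2 ≤ E i (N + k) (t N + s / γ) / e N ^ 2
    rw [div_pow, ← mul_div_assoc]
    exact div_le_div_of_nonneg_right (hsol.defect_lower i (N + k) _ hp) (sq_nonneg _)
  · -- (4.10), upper: the slack accrued before `t_N` plus the covariant integral, defect `κ₂ ≤ η`
    intro i k s hs
    have hp := hmaps hs
    have hcont : ContinuousOn (E i (N + k)) (Icc 0 T) := (hsol.contDiffOn_E i (N + k)).continuousOn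
    -- split the (4.10) time integral at `t_N`
    have hI1 : IntervalIntegrable (E i (N + k)) volume 0 (t N) := by
      refine (hcont.mono ?_).intervalIntegrable
      rw [Set.uIcc_of_le htN0]
      exact Icc_subset_Icc_right htT.le
    have hsp : t N ≤ t N + s / γ := by have := div_nonneg hs.1 hγpos.le; linarith
    have hI2 : IntervalIntegrable (E i (N + k)) volume (t N) (t N + s / γ) := by
      refine (hcont.mono ?_).intervalIntegrable
      rw [Set.uIcc_of_le hsp]
      exact Icc_subset_Icc htN0 hp.2
    have hsplitI := intervalIntegral.integral_add_adjacent_intervals hI1 hI2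
    -- the integral after `t_N` in restarted time
    have hIr : ∫ u in (0 : ℝ)..s, restartE ε₀ N (t N) (e N) E i k u =
        γ / e N ^ 2 * ∫ x in t N..(t N + s / γ), E i (N + k) x :=
      integral_restart hγpos.ne' (e N ^ 2) s
    have hIr' : ∫ x in t N..(t N + s / γ), E i (N + k) x =
        e N ^ 2 / γ * ∫ u in (0 : ℝ)..s, restartE ε₀ N (t N) (e N) E i k u := by
      rw [hIr]; field_simp
    have hF0 : 0 ≤ ∫ u in (0 : ℝ)..s, restartE ε₀ N (t N) (e N) E i k u :=
      intervalIntegral.integral_nonneg hs.1 fun u hu =>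
        div_nonneg (hsol.nonneg_E i (N + k) _ (hmaps ⟨hu.1, hu.2.trans hs.2⟩)) (sq_nonneg _)
    have hup := hsol.defect_upper i (N + k) _ hp
    rw [← hsplitI, hIr'] at hup
    show E i (N + k) (t N + s / γ) / e N ^ 2 ≤
      (1 / 2) * (X i (N + k) (t N + s / γ) / e N) ^ 2 + restartSlack ε₀ K₂ N (t N) (e N) E i k +
        η * (1 + ε₀) ^ ((2 : ℝ) * k) * ∫ u in (0 : ℝ)..s, restartE ε₀ N (t N) (e N) E i k u
    -- the coefficient of the restarted integral is `κ₂ (1+ε₀)^{2k} ≤ η (1+ε₀)^{2k}`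
    have hcoef : K₂ * (1 + ε₀) ^ ((2 : ℝ) * ((N + k : ℤ) : ℝ)) * (e N ^ 2 / γ) / e N ^ 2 ≤
        η * (1 + ε₀) ^ ((2 : ℝ) * k) := by
      have h1 : K₂ * (1 + ε₀) ^ ((2 : ℝ) * ((N + k : ℤ) : ℝ)) * (e N ^ 2 / γ) / e N ^ 2 =
          K₂ / (e N * (1 + ε₀) ^ ((N : ℝ) / 2)) * (1 + ε₀) ^ ((2 : ℝ) * k) := by
        rw [hγ, div_mul_eq_mul_div, eq_div_iff (mul_pos heN hQ2).ne']
        field_simp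
        rw [show K₂ * (1 + ε₀) ^ ((2 : ℝ) * ((N + k : ℤ) : ℝ)) * (1 + ε₀) ^ ((N : ℝ) / 2) =
            K₂ * ((1 + ε₀) ^ ((2 : ℝ) * ((N + k : ℤ) : ℝ)) * (1 + ε₀) ^ ((N : ℝ) / 2)) by ring,
          hsplit k]
        ring
      rw [h1]
      exact mul_le_mul_of_nonneg_right hκ₂ (Real.rpow_pos_of_pos hq _).le
    have hslack : K₂ * (1 + ε₀) ^ ((2 : ℝ) * ((N + k : ℤ) : ℝ)) *
        (∫ x in (0 : ℝ)..t N, E i (N + k) x) / e N ^ 2 = restartSlack ε₀ K₂ N (t N) (e N) E i k := by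
      unfold restartSlack
      push_cast
      ring
    calc E i (N + k) (t N + s / γ) / e N ^ 2
        ≤ ((1 / 2) * X i (N + k) (t N + s / γ) ^ 2 + K₂ * (1 + ε₀) ^ ((2 : ℝ) * ((N + k : ℤ) : ℝ)) *
            ((∫ x in (0 : ℝ)..t N, E i (N + k) x) +
              e N ^ 2 / γ * ∫ u in (0 : ℝ)..s, restartE ε₀ N (t N) (e N) E i k u)) / e N ^ 2 :=
          div_le_div_of_nonneg_right hup (sq_nonneg _)
      _ = (1 / 2) * (X i (N + k) (t N + s / γ) / e N) ^ 2 +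
            K₂ * (1 + ε₀) ^ ((2 : ℝ) * ((N + k : ℤ) : ℝ)) * (∫ x in (0 : ℝ)..t N, E i (N + k) x) /
              e N ^ 2 +
            K₂ * (1 + ε₀) ^ ((2 : ℝ) * ((N + k : ℤ) : ℝ)) * (e N ^ 2 / γ) / e N ^ 2 *
              ∫ u in (0 : ℝ)..s, restartE ε₀ N (t N) (e N) E i k u := by
          rw [div_pow]
          ring
      _ ≤ (1 / 2) * (X i (N + k) (t N + s / γ) / e N) ^ 2 + restartSlack ε₀ K₂ N (t N) (e N) E i k +
            η * (1 + ε₀) ^ ((2 : ℝ) * k) * ∫ u in (0 : ℝ)..s, restartE ε₀ N (t N) (e N) E i k u := by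
          rw [hslack]
          gcongr

/-- **`RestartControlOn 𝕊`, main lemma** (general number of modes, arbitrary shift set `𝕊`).
[cite: Tao2016AveragedNS, §6.4 Prop. 6.5 and Lemma 6.7 (rescaling at a checkpoint; defects O((1+ε₀)^{-n₀/2}); cumulative slack)] -/
theorem main {env : ℤ → ℝ} (hε₀ : 0 < ε₀) (hθ : θ ≤ 1 / 2) (hc : 0 ≤ c) (hη : 0 < η)
    (hX₀ : X₀ i₀ ≠ 0) (hK₁ : 0 ≤ K₁) (hK₂ : 0 ≤ K₂) :
    ∃ N₀ : ℤ, ∀ n₀ : ℤ, N₀ ≤ n₀ → ∀ T : ℝ, 0 < T → ∀ X E : Fin m → ℤ → ℝ → ℝ,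
      CascadeODESolutionOnShift 𝕊 T ε₀ α K₁ K₂ n₀ X₀ X E → ∀ N : ℤ, n₀ ≤ N → ∀ t e : ℤ → ℝ,
        EpochCheckpoints ε₀ θ c i₀ n₀ X₀ P (epochEnvelope env) N X E t e → t N < T →
          PseudoFlowOnShift 𝕊 ((T - t N) * (e N * (1 + ε₀) ^ ((5 : ℝ) * N / 2))) ε₀ α η η
              (fun i k => X i (N + k) (t N) / e N) (fun i k => E i (N + k) (t N) / e N ^ 2)
              (restartSlack ε₀ K₂ N (t N) (e N) E) (restartX ε₀ N (t N) (e N) X)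
              (restartE ε₀ N (t N) (e N) E) ∧
            ∀ i k, 0 ≤ restartSlack ε₀ K₂ N (t N) (e N) E i k ∧
              restartSlack ε₀ K₂ N (t N) (e N) E i k ≤
                η * slackWeight ε₀ θ c env (N - n₀).toNat k := by
  have hq : (0 : ℝ) < 1 + ε₀ := by linarith
  have ha : 0 < |X₀ i₀| := abs_pos.mpr hX₀
  have hηa : 0 < η * |X₀ i₀| := mul_pos hη ha
  obtain ⟨N₀, hN₀⟩ := exists_threshold hε₀ (max K₁ K₂ / (η * |X₀ i₀|))
  refine ⟨N₀, fun n₀ hn₀ T hT X E hsol N hN t e h htT => ?_⟩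
  have hB := hN₀ n₀ hn₀
  rw [div_le_iff₀ hηa] at hB
  have hK₁η : K₁ ≤ η * |X₀ i₀| * (1 + ε₀) ^ ((n₀ : ℝ) / 2) := by
    have := le_max_left K₁ K₂; nlinarith [Real.rpow_pos_of_pos hq ((n₀ : ℝ) / 2)]
  have hK₂η : K₂ ≤ η * |X₀ i₀| * (1 + ε₀) ^ ((n₀ : ℝ) / 2) := by
    have := le_max_right K₁ K₂; nlinarith [Real.rpow_pos_of_pos hq ((n₀ : ℝ) / 2)]
  have heN : 0 < e N := h.e_pos N hN le_rfl
  refine ⟨pseudoFlowOnShift_restart hε₀ hθ hK₁ hK₂ hK₁η hK₂η hsol hN h.toShellCheckpoints htT,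
    fun i k => ?_⟩
  exact restartSlack_le h hε₀ hc hN hK₂
    (kappa_le h.toShellCheckpoints hε₀ hθ hN hK₂ hK₂η)
    (fun i n => (hsol.contDiffOn_E i n).continuousOn) (fun i n u hu => hsol.nonneg_E i n u hu)
    htT.le i k


end Flow

end RestartControlOn

open RestartControlOn in
/-- **Item stmt-NavierStokesRegularity-22989** (`TaoLadderRungTwoFlat.RestartControlOn`): Tao's scale
covariance at a checkpoint with small defects and admissible slack, on the two-way shift set `S♭`
(`RestartControlOn.main` at `𝕊 = shiftSetFlat`). [cite: Tao2016AveragedNS, §6.4 Prop. 6.5 and Lemma 6.7] -/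
theorem taoLadderRungTwoFlat_restartControlOn_proof :
    Summit.NavierStokesRegularity.NavierStokesRegularity.Theses.TaoLadderRungTwoFlat.RestartControlOn := by
  unfold Summit.NavierStokesRegularity.NavierStokesRegularity.Theses.TaoLadderRungTwoFlat.RestartControlOn
  intro m ε₀ θ c η i₀ α X₀ P env K₁ K₂ hε₀ hθ hc hη hX₀ hK₁ hK₂
  exact main hε₀ hθ hc hη hX₀ hK₁ hK₂

end Summit.NavierStokesRegularity.NavierStokesRegularity.Theorems

end
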